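import Summits.QuantumFields.YangMills.Theorems.BalabanUVNodesN19TubeDecayAtU3PinFromLetters
import Summits.QuantumFields.YangMills.Theorems.BalabanUVNodesD4KernelDecayOfWindowed
import Literature.MathematicalPhysics.QuantumFieldTheory.Balaban1983to89.Node00.U3KernelLetters

/-!
# BalabanUVNodes ∕ N19 — THE DIRECTION PAIRS OF THE (T) INPUT AT THE (t-U3) PIN: stub 1's bill carries the (5.10) letter at the pair `(0, 1)`
# only; NODE O's tube block (T) reads it at ALL 16 pairs; modulo Euclidean covariance of the limiting kernels ([I] (1.21) ∕ (5.6)) and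
# N22's slot, (T) ⟺ (D4) at `(0, 1)` ∧ (D4) at `(0, 0)` — otherwise it is 16 components of the same located letter

Cell `pub-ymgap`, HUMAN RULING D-0062 (Track A) ∕ D-0149 ∕ D-0154 (director-ym R399 (3a), №207 width wave), width seat `pub-ymgap-dag-n19-w5`
(harness re-seat g1 of generation 0), FILE 4.  THEOREMS ONLY (0 `def`, 0 `instance`, 0 `sorry`); imports this seat's FILE 3
`BalabanUVNodesN19TubeDecayAtU3PinFromLetters`, dag-n22-w3's `BalabanUVNodesD4KernelDecayOfWindowed` and def-W1's W1-21 `Node00/U3KernelLetters` (the two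
letter names `PolLimitsExistOfRecord₁₃ ∕ WindowedDecayOfRecord₁₃`) ONLY; modifies nothing;
`--kind proof --supports` K3⁷ `SpineGivenEndpointR13SepCoPH` (stmt-QuantumFields-20544) `--as helper` — COUNT-NEUTRAL.  [I] = [Balaban1987RG1].

WHY.  FILE 2∕3 of this seat showed: at K3⁷ v5's (t-U3) pin `U3PinnedKernels 𝔯 ℓ` the tube block (T) of the N19′ link reading (in dag-n19-w3's keyed edition:
`DecayBound R.u3.EA (Window γ) E₀T R.u3.κ ∧ 0 ≤ E₀T`, `E₀T` bound nowhere else) is EQUIVALENT, modulo N22's slot `N22At R.u3` (`ω < 1`) and the letter signs, to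
the (D4)-type letter `KernelDecayOfRecord₁₃ F N θ μ ν ℓ.κ` AT EVERY DIRECTION PAIR `(μ, ν) : Fin 4 × Fin 4` — the carrier of def-W1's kernel objects is
`Dom = ℕ × Fin 4 × Fin 4 × ℤ⁴`, diagonal pairs included (FILE 3's `decayBound_atPin_iff_kernelDecayOfRecord₁₃`).  But the bill behind stub 1's rates conjunct
(dag-n27-w1 `K3V5Defs.keyedRatesHolderD4_rrOfRecord_of_pins_of_letters`, via `…N27AtKernelPinnedReading13CoPHLetters.kernelDecayOfRecord₁₃_of_letters_guarded`)
carries def-W1's windowed (5.10) letter `WindowedDecayOfRecord₁₃ F N θ 0 1 κ` AT THE PAIR `(0, 1)` ONLY — exactly what (D4)'s (1.22) read-out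
`readOutAt_objectsOfRecord₁₃_coPH` consumes ([I] p. 264: «for μ, ν arbitrary, μ ≠ ν»).  So a K3⁷ closer that wants (T) to LEAVE NODE O's binder on FILE 3 must carry
MORE than stub 1's bill.  This file says exactly how much more, in two currencies, with the transport kernel-checked:
* §1 [folklore, any dimension `d`, `B12Beta.Kernel d`] (5.10)-decay `B12Sec2to5.Decay510` is transported along coordinate permutations by the printed covariance
  `B12Beta.PermCovariant` ([I] (1.21) p. 264 second line ∕ (5.6) p. 292: `Π_{σμ,σν}(x ∘ σ⁻¹) = Π_{μν}(x)`; `|x ∘ σ|₁ = |x|₁`) with the SAME constant and rate: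
  `decay510_perm_of_permCovariant`; hence from ONE off-diagonal pair to EVERY off-diagonal pair (`decay510_of_ne_of_ne` — the permutation with `σ μ = μ'`,
  `σ ν = ν'` of `B12Beta.secondMoment_pair_indep`, inlined) and from ONE diagonal pair to EVERY diagonal pair (`decay510_diag_of_diag`, a transposition); a
  coordinate permutation never maps an off-diagonal pair to a diagonal one, so for `d = 4` the sixteen pairs cost TWO components: `decay510_all_of_offDiag_diag`
  ((0,1) with `C₁` and (0,0) with `C₀` ⟹ all pairs with `max C₀ C₁`).
* §2 [bookkeeping, def-W1's generic kernel objects `U3OfKernels.kernelA F ℰ ρ bV`] covariance of the limiting (1.21) kernels as a DISPLAYED HYPOTHESIS SHAPE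
  `∀ g ∈ W, ∀ k, PermCovariant (kernelA F ℰ ρ bV g k)` (stated inline — `Node00/BetaOfRecord` lists `PermCovariant` under «WHAT IS NOT HERE»; no definer object is
  asked): `kernelDecay_all_of_offDiag_diag` (`KernelDecay W 0 1 κ → KernelDecay W 0 0 κ → covariance → ∀ μ ν, KernelDecay W μ ν κ`, per-sequence constants
  `max`-ed); and the covariance letter itself is the (1.21) LIMIT of a finite-volume one: `polLimit_perm_of_eventuallyEq` ∕ `permCovariant_kernelA_of_eventually` —
  if the windowed kernels `polWindow F K (k+1) …` are covariant EVENTUALLY in `K`, the `limUnder` kernel `kernelA … g k` is covariant, UNCONDITIONALLY (two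
  eventually-equal sequences have the same `limUnder`; no `PolLimitExists` needed).
* §3 [bookkeeping, at the record ∕ the pin] `kernelDecayOfRecord₁₃_all_of_offDiag_diag` (the record's β-chart instances bound by `letI` as in
  `kernelDecayOfRecord₁₃_of_windowed`); ★ `decayBound_atPin_of_offDiag_diag_of_n22At` and ★ `decayBound_atPin_iff_offDiag_diag`: under covariance of the record's
  limiting kernels on the window, N22's slot at the pinned bundle and `0 ≤ ℓ.C₉`, `0 ≤ ℓ.ω < 1`, `0 < θ.γ`, (T)'s decay input
  `∃ E₀ ≥ 0, DecayBound (pinned EA) (Window θ.γ) E₀ ℓ.κ` ⟺ `KernelDecayOfRecord₁₃ … 0 1 ℓ.κ ∧ KernelDecayOfRecord₁₃ … 0 0 ℓ.κ`; the COVARIANCE-FREE road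
  `kernelDecayOfRecord₁₃_all_of_windowed_all` ∕ ★ `decayBound_atPin_of_windowed_all_of_n22At` from `PolLimitsExistOfRecord₁₃` (already in stub 1's bill) and
  W1's windowed letter AT ALL PAIRS `∀ μ ν, WindowedDecayOfRecord₁₃ … μ ν ℓ.κ` (dag-n22-w3's `kernelDecayOfRecord₁₃_of_windowed` per pair); and both under the pin
  equation at the reading's bundle `(rateCarriersOfRecord₁₃CoPH 𝔯 F θ hP g₀ os k).u3`, on every tuning window `γ' ≤ θ.γ` (the shape of dag-n19-w3's binder).

LOCATED (count-neutral; for the plan's v6 precut letter list and dag-n19-w3's next keyed edition).  For (T) to leave NODE O's binder `hlinkKeyed`, the uniform-letters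
hypothesis of a K3⁷ closer needs, BEYOND stub 1's bill (which has `PolLimitsExistOfRecord₁₃`, `WindowedNE9OfRecord₁₃` — N22's slot — and `WindowedDecayOfRecord₁₃ … 0 1`):
EITHER (a) `WindowedDecayOfRecord₁₃ F 2 θ μ ν (ℓ F θ).κ` at the 15 remaining pairs ([I] (5.10) p. 293 is printed for the full tensor `Π_{μν}`), OR (b) its `(0, 0)`
component plus covariance of the limiting kernels of record under the coordinate permutations ([I] (1.21) p. 264 ∕ (5.6) p. 292; finite-volume-eventual suffices, §2).
Neither is an estimate this file proves; both are HYPOTHESIS SHAPES inhabited for no family today.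

HONEST FRAMING.  Finite sums, `Equiv` re-indexing, `max`, `Filter.limUnder` congruence, over HYPOTHESIS shapes; ZERO estimate content; covariance and (5.10) decay of the
record's kernels are DISPLAYED HYPOTHESES, NOT asserted; NE7 ∕ (5.10)-at-the-record NOT PRINTED as two-run statements for d = 4 and NOT proved; no stub closed; N19 ∕ N22
NOT discharged; K3⁷ OPEN, skeleton v5 UNTOUCHED; counts UNMOVED (typed 28∕28 · discharged 5∕27 · A 5∕28).  One finite 𝕋⁴ at fixed ε — R4 closes the CONDITIONAL
rung `BalabanLadder.UV` only; the Yang–Mills mass gap (Clay) is NOT proved by any of this.  [folklore] ∕ [bookkeeping] throughout.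
-/

noncomputable section

namespace Summit.QuantumFields.YangMills.BalabanUVNodes.N19TubeDecayDirectionPairs

open Finset Filter Topology
open scoped BigOperators
open Literature.MathematicalPhysics.QuantumFieldTheory.Balaban1983to89
open Literature.MathematicalPhysics.QuantumFieldTheory.Balaban1983to89.T4Continuum (T4Family ULoop)
open Literature.MathematicalPhysics.QuantumFieldTheory.Balaban1983to89.T4OutputRate (Window DecayBound)
open Literature.MathematicalPhysics.QuantumFieldTheory.Balaban1983to89.Node00 (Stage13Params Stage13HParams U3Letters₁₁ TermFamily1 polWindow polLimit
  mergedTermFamilyMatT TβOfRecord₁₃ chiβOfRecord₁₃)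
open Literature.MathematicalPhysics.QuantumFieldTheory.Balaban1983to89.Node00.U3OfKernels (objectsOfRecord₁₃ histPrefix kernelA kernelA_eq KernelDecay
  KernelDecayOfRecord₁₃)
open Literature.MathematicalPhysics.QuantumFieldTheory.Balaban1983to89.Node00.U3KernelLetters (PolLimitsExistOfRecord₁₃ WindowedDecayOfRecord₁₃)
open Literature.MathematicalPhysics.QuantumFieldTheory.Balaban1983to89.B12Sec2to5 (l1 Decay510)
open Literature.MathematicalPhysics.QuantumFieldTheory.Balaban1983to89.B12Beta (Kernel PermCovariant)
open YMDAG.UVSplit (RateReading₁₃CoPH N22At u3OfRecord₁₃ rateCarriersOfRecord₁₃CoPH)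
open YMDAG.N22.AtKernels (kernelDecayOfRecord₁₃_of_windowed)
open Summit.QuantumFields.YangMills.BalabanUVNodes.N19LinkReadingAtU3Pin (kernelDecayOfRecord₁₃_of_decayBound u3_rateCarriersOfRecord₁₃CoPH_of_pin)
open Summit.QuantumFields.YangMills.BalabanUVNodes.N19TubeDecayAtU3PinFromLetters (decayBound_atPin_of_kernelDecayOfRecord₁₃_of_n22At
  decayBound_atPin_tuningWindow)

/-! ## §1 Generic: (5.10)-decay along coordinate permutations under the printed covariance -/

section Generic

variable {d : ℕ}

/-- **(5.10) TRANSPORTS ALONG A COORDINATE PERMUTATION UNDER (1.21)∕(5.6) COVARIANCE, SAME CONSTANT AND RATE** [folklore]: if `Π_{σμ,σν}(x ∘ σ⁻¹) = Π_{μν}(x)`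
for all `σ, μ, ν, x` and `|Π_{μν}(x)| ≤ C e^{−κ|x|₁}`, then `|Π_{σμ,σν}(x)| ≤ C e^{−κ|x|₁}` (`Π_{σμ,σν}(x) = Π_{μν}(x ∘ σ)` and `|x ∘ σ|₁ = |x|₁`). [folklore] -/
theorem decay510_perm_of_permCovariant {P : Kernel d} (hP : PermCovariant P) {μ ν : Fin d} {C κ : ℝ} (h : Decay510 (P μ ν) C κ)
    (σ : Equiv.Perm (Fin d)) : Decay510 (P (σ μ) (σ ν)) C κ := by
  intro x
  -- `|x ∘ σ|₁ = |x|₁`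
  have hl1 : l1 (x ∘ σ) = l1 x := by
    unfold l1
    exact Equiv.sum_comp σ (fun i => |(x i : ℝ)|)
  -- `Π_{σμ,σν}(x) = Π_{μν}(x ∘ σ)`
  have hx : P (σ μ) (σ ν) x = P μ ν (x ∘ σ) := by
    have h1 := hP σ μ ν (x ∘ σ)
    have hcomp : (x ∘ σ) ∘ σ.symm = x := by
      funext i
      simp only [Function.comp_apply, Equiv.apply_symm_apply]
    rwa [hcomp] at h1
  rw [hx, ← hl1]
  exact h (x ∘ σ)

/-- **FROM ONE OFF-DIAGONAL PAIR TO ANY OTHER** [folklore]: under covariance, (5.10) at `(μ, ν)`, `μ ≠ ν`, gives (5.10) at every `(μ', ν')`, `μ' ≠ ν'`, same constant and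
rate (the coordinate permutation with `σ μ = μ'`, `σ ν = ν'`, as in `B12Beta.secondMoment_pair_indep`). [folklore] -/
theorem decay510_of_ne_of_ne {P : Kernel d} (hP : PermCovariant P) {μ ν μ' ν' : Fin d} (hμν : μ ≠ ν) (hμν' : μ' ≠ ν') {C κ : ℝ}
    (h : Decay510 (P μ ν) C κ) : Decay510 (P μ' ν') C κ := by
  -- a coordinate permutation with `σ μ = μ'`, `σ ν = ν'`
  obtain ⟨σ, hσμ, hσν⟩ : ∃ σ : Equiv.Perm (Fin d), σ μ = μ' ∧ σ ν = ν' := by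
    have h1 : Equiv.swap μ μ' μ = μ' := Equiv.swap_apply_left μ μ'
    have hne : Equiv.swap μ μ' ν ≠ μ' := fun hc => hμν ((Equiv.swap μ μ').injective (hc.trans h1.symm)).symm
    refine ⟨(Equiv.swap μ μ').trans (Equiv.swap (Equiv.swap μ μ' ν) ν'), ?_, ?_⟩
    · show Equiv.swap (Equiv.swap μ μ' ν) ν' (Equiv.swap μ μ' μ) = μ'
      rw [h1]
      exact Equiv.swap_apply_of_ne_of_ne hne.symm hμν'
    · show Equiv.swap (Equiv.swap μ μ' ν) ν' (Equiv.swap μ μ' ν) = ν'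
      exact Equiv.swap_apply_left _ _
  subst hσμ hσν
  exact decay510_perm_of_permCovariant hP h σ

/-- **FROM ONE DIAGONAL PAIR TO ANY OTHER** [folklore]: under covariance, (5.10) at `(μ, μ)` gives (5.10) at every `(μ', μ')`, same constant and rate (the transposition
`μ ↔ μ'`).  A coordinate permutation never maps an off-diagonal pair to a diagonal one: the diagonal is a SEPARATE component. [folklore] -/
theorem decay510_diag_of_diag {P : Kernel d} (hP : PermCovariant P) (μ μ' : Fin d) {C κ : ℝ} (h : Decay510 (P μ μ) C κ) :
    Decay510 (P μ' μ') C κ := by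
  have h1 := decay510_perm_of_permCovariant hP h (Equiv.swap μ μ')
  rwa [Equiv.swap_apply_left] at h1

/-- **FOR `d = 4`: ALL SIXTEEN PAIRS FROM THE TWO COMPONENTS `(0, 1)` AND `(0, 0)`** [folklore]: under covariance, (5.10) at `(0, 1)` with constant `C₁` and at `(0, 0)` with
constant `C₀` give (5.10) at every pair with the one constant `max C₀ C₁` (same rate). [folklore] -/
theorem decay510_all_of_offDiag_diag {P : Kernel 4} (hP : PermCovariant P) {C₀ C₁ κ : ℝ} (h01 : Decay510 (P 0 1) C₁ κ) (h00 : Decay510 (P 0 0) C₀ κ)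
    (μ ν : Fin 4) : Decay510 (P μ ν) (max C₀ C₁) κ := by
  intro x
  by_cases hμν : μ = ν
  · subst hμν
    exact (decay510_diag_of_diag hP 0 μ h00 x).trans (mul_le_mul_of_nonneg_right (le_max_left _ _) (Real.exp_pos _).le)
  · exact (decay510_of_ne_of_ne hP (by decide : (0 : Fin 4) ≠ 1) hμν h01 x).trans
      (mul_le_mul_of_nonneg_right (le_max_right _ _) (Real.exp_pos _).le)

/-- The converse bookkeeping: (5.10) at every pair with per-pair constants gives ONE constant for all pairs (`Σ_{μν} |C μ ν|`; no covariance needed). [folklore] -/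
theorem decay510_all_uniform_of_all {P : Kernel 4} {κ : ℝ} {C : Fin 4 → Fin 4 → ℝ} (h : ∀ μ ν, Decay510 (P μ ν) (C μ ν) κ) (μ ν : Fin 4) :
    Decay510 (P μ ν) (∑ μ', ∑ ν', |C μ' ν'|) κ := by
  intro x
  have hle : C μ ν ≤ ∑ μ', ∑ ν', |C μ' ν'| :=
    (le_abs_self _).trans ((Finset.single_le_sum (f := fun ν' => |C μ ν'|) (fun _ _ => abs_nonneg _) (Finset.mem_univ ν)).trans
      (Finset.single_le_sum (f := fun μ' => ∑ ν', |C μ' ν'|) (fun _ _ => Finset.sum_nonneg fun _ _ => abs_nonneg _) (Finset.mem_univ μ)))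
  exact (h μ ν x).trans (mul_le_mul_of_nonneg_right hle (Real.exp_pos _).le)

end Generic

/-! ## §2 At def-W1's kernel objects (generic term family): covariance of the limiting kernels as a hypothesis shape -/

/-- **`limUnder` RESPECTS EVENTUAL EQUALITY** (no convergence needed): two real sequences that agree eventually have the same `limUnder atTop`. [folklore] -/
theorem limUnder_congr_of_eventuallyEq {a b : ℕ → ℝ} (h : a =ᶠ[atTop] b) : limUnder atTop a = limUnder atTop b := by
  unfold limUnder
  rw [Filter.map_congr h]

section Kernels

variable {𝔄 : Type*} [NormedRing 𝔄] [NormedAlgebra ℝ 𝔄]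
variable {V : Type*} [NormedAddCommGroup V] [NormedSpace ℝ V] {ι : Type*} [Fintype ι]
variable (F : T4Family) (ℰ : TermFamily1 F 𝔄) (ρ : V →L[ℝ] 𝔄) (bV : Module.Basis ι ℝ V)

/-- **`KernelDecay` AT EVERY PAIR FROM ITS `(0, 1)` AND `(0, 0)` COMPONENTS UNDER COVARIANCE OF THE LIMITING KERNELS** [bookkeeping]: on a set `W` of coupling sequences,
if every limiting kernel `kernelA F ℰ ρ bV g k` (`g ∈ W`, every level) is `PermCovariant`, then the (5.10)-class binders at `(0, 1)` and at `(0, 0)` (one constant per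
sequence, uniform in the level) give the binder at every `(μ, ν)` (constant `max C₀(g) C₁(g)`). [folklore] -/
theorem kernelDecay_all_of_offDiag_diag {W : Set (ℕ → ℝ)} {κ : ℝ} (hcov : ∀ g ∈ W, ∀ k : ℕ, PermCovariant (kernelA F ℰ ρ bV g k))
    (h01 : KernelDecay F ℰ ρ bV W 0 1 κ) (h00 : KernelDecay F ℰ ρ bV W 0 0 κ) (μ ν : Fin 4) : KernelDecay F ℰ ρ bV W μ ν κ := by
  intro g hg
  obtain ⟨C₁, hC₁⟩ := h01 g hg
  obtain ⟨C₀, hC₀⟩ := h00 g hg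
  exact ⟨max C₀ C₁, fun k => decay510_all_of_offDiag_diag (hcov g hg k) (hC₁ k) (hC₀ k) μ ν⟩

/-- Under covariance the (5.10)-class binder at one off-diagonal pair gives it at every off-diagonal pair. [folklore] -/
theorem kernelDecay_of_ne_of_ne {W : Set (ℕ → ℝ)} {κ : ℝ} (hcov : ∀ g ∈ W, ∀ k : ℕ, PermCovariant (kernelA F ℰ ρ bV g k))
    {μ ν μ' ν' : Fin 4} (hμν : μ ≠ ν) (hμν' : μ' ≠ ν') (h : KernelDecay F ℰ ρ bV W μ ν κ) : KernelDecay F ℰ ρ bV W μ' ν' κ := by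
  intro g hg
  obtain ⟨C, hC⟩ := h g hg
  exact ⟨C, fun k => decay510_of_ne_of_ne (hcov g hg k) hμν hμν' (hC k)⟩

/-- **COVARIANCE PASSES TO THE (1.21) LIMIT KERNEL, UNCONDITIONALLY** [bookkeeping]: if the windowed finite-volume kernels of a `K`-indexed family are covariant under a
coordinate permutation `σ` EVENTUALLY in `K`, so is the total `polLimit` kernel (its entries are `limUnder`s of eventually equal sequences). [folklore] -/
theorem polLimit_perm_of_eventuallyEq (j : ℕ) (ℰ' : (K : ℕ) → (Fin (F.P K).d → Site (F.P K) j → 𝔄) → ℝ) (σ : Equiv.Perm (Fin 4)) (μ ν : Fin 4)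
    (z : Fin 4 → ℤ) (h : ∀ᶠ K in atTop, polWindow F K j (ℰ' K) ρ bV (σ μ) (σ ν) (z ∘ σ.symm) = polWindow F K j (ℰ' K) ρ bV μ ν z) :
    polLimit F j ℰ' ρ bV (σ μ) (σ ν) (z ∘ σ.symm) = polLimit F j ℰ' ρ bV μ ν z :=
  limUnder_congr_of_eventuallyEq h

/-- ★ **THE COVARIANCE LETTER OF THE LIMITING KERNELS FROM EVENTUAL FINITE-VOLUME COVARIANCE** [bookkeeping]: if for every `g ∈ W`, level `k`, permutation `σ`, pair and
separation the windowed kernels `Π^{(K)}_{k+1}` of the term `ℰ k (g_0, …, g_k)` are covariant eventually in `K`, then every `kernelA F ℰ ρ bV g k` is `PermCovariant` — no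
existence of the (1.21) limits is needed for this passage. [folklore] -/
theorem permCovariant_kernelA_of_eventually {W : Set (ℕ → ℝ)}
    (h : ∀ g ∈ W, ∀ (k : ℕ) (σ : Equiv.Perm (Fin 4)) (μ ν : Fin 4) (z : Fin 4 → ℤ), ∀ᶠ K in atTop,
      polWindow F K (k + 1) (ℰ k (histPrefix g k) K) ρ bV (σ μ) (σ ν) (z ∘ σ.symm) = polWindow F K (k + 1) (ℰ k (histPrefix g k) K) ρ bV μ ν z) :
    ∀ g ∈ W, ∀ k : ℕ, PermCovariant (kernelA F ℰ ρ bV g k) := by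
  intro g hg k σ μ ν z
  rw [kernelA_eq]
  exact polLimit_perm_of_eventuallyEq F ρ bV (k + 1) _ σ μ ν z (h g hg k σ μ ν z)

end Kernels

/-! ## §3 At the record and at the pin -/

section Record

open scoped Matrix.Norms.L2Operator

variable {N : ℕ} [NeZero N] {F : T4Family}

/-- **`KernelDecayOfRecord₁₃` AT EVERY PAIR FROM ITS `(0, 1)` AND `(0, 0)` COMPONENTS** [bookkeeping], under covariance of the record's limiting kernels on the record window
(the merged term family of record in the record's β-chart, instances bound by `letI` as in `kernelDecayOfRecord₁₃_of_windowed`). [folklore] -/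
theorem kernelDecayOfRecord₁₃_all_of_offDiag_diag (θ : Stage13Params F N) {κ : ℝ}
    (hcov : letI := θ.instVβ₁; letI := θ.instVβ₂; letI := θ.instιβ
      ∀ g ∈ Window θ.γ, ∀ k : ℕ, PermCovariant (kernelA F (mergedTermFamilyMatT F N (TβOfRecord₁₃ F N) (chiβOfRecord₁₃ F N θ) θ.εbg) θ.ρ8 θ.bV g k))
    (h01 : KernelDecayOfRecord₁₃ F N θ 0 1 κ) (h00 : KernelDecayOfRecord₁₃ F N θ 0 0 κ) (μ ν : Fin 4) : KernelDecayOfRecord₁₃ F N θ μ ν κ := by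
  letI := θ.instVβ₁; letI := θ.instVβ₂; letI := θ.instιβ
  exact kernelDecay_all_of_offDiag_diag F _ θ.ρ8 θ.bV hcov h01 h00 μ ν

/-- **THE COVARIANCE-FREE ROAD: `KernelDecayOfRecord₁₃` AT EVERY PAIR FROM def-W1's TWO LETTERS, THE WINDOWED ONE AT EVERY PAIR** [bookkeeping]
(`PolLimitsExistOfRecord₁₃` + `∀ μ ν, WindowedDecayOfRecord₁₃ … μ ν κ`; dag-n22-w3's `kernelDecayOfRecord₁₃_of_windowed` per pair). [folklore] -/
theorem kernelDecayOfRecord₁₃_all_of_windowed_all (θ : Stage13Params F N) {κ : ℝ} (hL : PolLimitsExistOfRecord₁₃ F N θ)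
    (hW : ∀ μ ν : Fin 4, WindowedDecayOfRecord₁₃ F N θ μ ν κ) (μ ν : Fin 4) : KernelDecayOfRecord₁₃ F N θ μ ν κ :=
  kernelDecayOfRecord₁₃_of_windowed F N θ μ ν κ hL (hW μ ν)

variable (θ : Stage13Params F N) (ℓ : U3Letters₁₁) (k : ℕ)

/-- ★ **(T)'s DECAY INPUT AT THE PIN FROM THE TWO COMPONENTS `(0, 1)`, `(0, 0)` OF THE (D4)-TYPE LETTER, COVARIANCE AND N22's SLOT** [bookkeeping]: SOME `E₀ ≥ 0` with
`DecayBound (pinned EA) (Window θ.γ) E₀ ℓ.κ` (FILE 3's `decayBound_atPin_of_kernelDecayOfRecord₁₃_of_n22At` after the §1–§3 transport to all sixteen pairs). [folklore] -/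
theorem decayBound_atPin_of_offDiag_diag_of_n22At
    (hcov : letI := θ.instVβ₁; letI := θ.instVβ₂; letI := θ.instιβ
      ∀ g ∈ Window θ.γ, ∀ k : ℕ, PermCovariant (kernelA F (mergedTermFamilyMatT F N (TβOfRecord₁₃ F N) (chiβOfRecord₁₃ F N θ) θ.εbg) θ.ρ8 θ.bV g k))
    (h01 : KernelDecayOfRecord₁₃ F N θ 0 1 ℓ.κ) (h00 : KernelDecayOfRecord₁₃ F N θ 0 0 ℓ.κ)
    (h22 : N22At (u3OfRecord₁₃ θ (objectsOfRecord₁₃ F N θ ℓ) k)) (hC₉ : 0 ≤ ℓ.C₉) (hω0 : 0 ≤ ℓ.ω) (hω1 : ℓ.ω < 1) (hγ : 0 < θ.γ) :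
    ∃ E₀ : ℝ, 0 ≤ E₀ ∧ DecayBound (u3OfRecord₁₃ θ (objectsOfRecord₁₃ F N θ ℓ) k).EA (Window θ.γ) E₀ ℓ.κ :=
  decayBound_atPin_of_kernelDecayOfRecord₁₃_of_n22At θ ℓ k (kernelDecayOfRecord₁₃_all_of_offDiag_diag θ hcov h01 h00) h22 hC₉ hω0 hω1 hγ

/-- ★ **AT THE PIN, MODULO COVARIANCE, N22's SLOT AND THE LETTER SIGNS: (T)'s DECAY INPUT ⟺ THE (D4)-TYPE LETTER AT `(0, 1)` AND AT `(0, 0)`** [bookkeeping]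
(⟹ FILE 2's `kernelDecayOfRecord₁₃_of_decayBound` at the two pairs; ⟸ the previous theorem). [folklore] -/
theorem decayBound_atPin_iff_offDiag_diag
    (hcov : letI := θ.instVβ₁; letI := θ.instVβ₂; letI := θ.instιβ
      ∀ g ∈ Window θ.γ, ∀ k : ℕ, PermCovariant (kernelA F (mergedTermFamilyMatT F N (TβOfRecord₁₃ F N) (chiβOfRecord₁₃ F N θ) θ.εbg) θ.ρ8 θ.bV g k))
    (h22 : N22At (u3OfRecord₁₃ θ (objectsOfRecord₁₃ F N θ ℓ) k)) (hC₉ : 0 ≤ ℓ.C₉) (hω0 : 0 ≤ ℓ.ω) (hω1 : ℓ.ω < 1) (hγ : 0 < θ.γ) :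
    (∃ E₀ : ℝ, 0 ≤ E₀ ∧ DecayBound (u3OfRecord₁₃ θ (objectsOfRecord₁₃ F N θ ℓ) k).EA (Window θ.γ) E₀ ℓ.κ) ↔
      (KernelDecayOfRecord₁₃ F N θ 0 1 ℓ.κ ∧ KernelDecayOfRecord₁₃ F N θ 0 0 ℓ.κ) :=
  ⟨fun ⟨_, _, h⟩ => ⟨kernelDecayOfRecord₁₃_of_decayBound θ ℓ k h 0 1, kernelDecayOfRecord₁₃_of_decayBound θ ℓ k h 0 0⟩,
    fun h => decayBound_atPin_of_offDiag_diag_of_n22At θ ℓ k hcov h.1 h.2 h22 hC₉ hω0 hω1 hγ⟩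

/-- ★ **THE COVARIANCE-FREE ROAD AT THE PIN** [bookkeeping]: (T)'s decay input on every tuning window `γ' ≤ θ.γ` from `PolLimitsExistOfRecord₁₃`, W1's windowed (5.10)
letter AT EVERY PAIR, N22's slot and the letter signs. [folklore] -/
theorem decayBound_atPin_of_windowed_all_of_n22At (hL : PolLimitsExistOfRecord₁₃ F N θ) (hW : ∀ μ ν : Fin 4, WindowedDecayOfRecord₁₃ F N θ μ ν ℓ.κ)
    (h22 : N22At (u3OfRecord₁₃ θ (objectsOfRecord₁₃ F N θ ℓ) k)) (hC₉ : 0 ≤ ℓ.C₉) (hω0 : 0 ≤ ℓ.ω) (hω1 : ℓ.ω < 1) (hγ : 0 < θ.γ)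
    {γ' : ℝ} (hγ' : γ' ≤ θ.γ) :
    ∃ E₀ : ℝ, 0 ≤ E₀ ∧ DecayBound (u3OfRecord₁₃ θ (objectsOfRecord₁₃ F N θ ℓ) k).EA (Window γ') E₀ ℓ.κ :=
  decayBound_atPin_tuningWindow θ ℓ k (kernelDecayOfRecord₁₃_all_of_windowed_all θ hL hW) h22 hC₉ hω0 hω1 hγ hγ'

/-- On every tuning window `γ' ≤ θ.γ`, the two-component road. [folklore] -/
theorem decayBound_atPin_tuningWindow_of_offDiag_diag
    (hcov : letI := θ.instVβ₁; letI := θ.instVβ₂; letI := θ.instιβ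
      ∀ g ∈ Window θ.γ, ∀ k : ℕ, PermCovariant (kernelA F (mergedTermFamilyMatT F N (TβOfRecord₁₃ F N) (chiβOfRecord₁₃ F N θ) θ.εbg) θ.ρ8 θ.bV g k))
    (h01 : KernelDecayOfRecord₁₃ F N θ 0 1 ℓ.κ) (h00 : KernelDecayOfRecord₁₃ F N θ 0 0 ℓ.κ)
    (h22 : N22At (u3OfRecord₁₃ θ (objectsOfRecord₁₃ F N θ ℓ) k)) (hC₉ : 0 ≤ ℓ.C₉) (hω0 : 0 ≤ ℓ.ω) (hω1 : ℓ.ω < 1) (hγ : 0 < θ.γ)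
    {γ' : ℝ} (hγ' : γ' ≤ θ.γ) :
    ∃ E₀ : ℝ, 0 ≤ E₀ ∧ DecayBound (u3OfRecord₁₃ θ (objectsOfRecord₁₃ F N θ ℓ) k).EA (Window γ') E₀ ℓ.κ :=
  decayBound_atPin_tuningWindow θ ℓ k (kernelDecayOfRecord₁₃_all_of_offDiag_diag θ hcov h01 h00) h22 hC₉ hω0 hω1 hγ hγ'

end Record

/-! ## §4 Under the pin equation, at the reading's bundle (the shape of dag-n19-w3's keyed binder) -/

section Pinned

open scoped Matrix.Norms.L2Operator

variable {N : ℕ} [NeZero N] (𝔯 : RateReading₁₃CoPH N) {F : T4Family} (θ : Stage13HParams F N) (hP : θ.Provisos₁₃CoPH F N) (g₀ : ℕ → ℝ)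
  (os : List (ULoop F)) (ℓ : U3Letters₁₁) (hpin : (𝔯.lit F θ hP g₀ os).u3 = objectsOfRecord₁₃ F N θ.toStage13Params ℓ) (k : ℕ)

include hpin

/-- ★ **AT THE READING UNDER THE PIN, TWO-COMPONENT ROAD**: (T)'s decay on every tuning window from the (D4)-type letter at `(0, 1)` and `(0, 0)`, covariance of the
record's limiting kernels, the bundle's N22 slot and the letter signs. [folklore] -/
theorem decayBound_rateCarriersOfRecord₁₃CoPH_of_pin_of_offDiag_diag
    (hcov : letI := θ.instVβ₁; letI := θ.instVβ₂; letI := θ.instιβ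
      ∀ g ∈ Window θ.γ, ∀ k : ℕ, PermCovariant (kernelA F (mergedTermFamilyMatT F N (TβOfRecord₁₃ F N) (chiβOfRecord₁₃ F N θ.toStage13Params) θ.εbg)
        θ.ρ8 θ.bV g k))
    (h01 : KernelDecayOfRecord₁₃ F N θ.toStage13Params 0 1 ℓ.κ) (h00 : KernelDecayOfRecord₁₃ F N θ.toStage13Params 0 0 ℓ.κ)
    (h22 : N22At (rateCarriersOfRecord₁₃CoPH 𝔯 F θ hP g₀ os k).u3) (hC₉ : 0 ≤ ℓ.C₉) (hω0 : 0 ≤ ℓ.ω) (hω1 : ℓ.ω < 1) (hγ : 0 < θ.γ)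
    {γ' : ℝ} (hγ' : γ' ≤ θ.γ) :
    ∃ E₀ : ℝ, 0 ≤ E₀ ∧ DecayBound (rateCarriersOfRecord₁₃CoPH 𝔯 F θ hP g₀ os k).u3.EA (Window γ') E₀ (rateCarriersOfRecord₁₃CoPH 𝔯 F θ hP g₀ os k).u3.κ := by
  rw [u3_rateCarriersOfRecord₁₃CoPH_of_pin 𝔯 θ hP g₀ os ℓ hpin k] at h22 ⊢
  exact decayBound_atPin_tuningWindow_of_offDiag_diag _ ℓ k hcov h01 h00 h22 hC₉ hω0 hω1 hγ hγ'

/-- ★ **AT THE READING UNDER THE PIN, COVARIANCE-FREE ROAD**: (T)'s decay on every tuning window from `PolLimitsExistOfRecord₁₃`, W1's windowed (5.10) letter AT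
EVERY PAIR, the bundle's N22 slot and the letter signs. [folklore] -/
theorem decayBound_rateCarriersOfRecord₁₃CoPH_of_pin_of_windowed_all (hL : PolLimitsExistOfRecord₁₃ F N θ.toStage13Params)
    (hW : ∀ μ ν : Fin 4, WindowedDecayOfRecord₁₃ F N θ.toStage13Params μ ν ℓ.κ)
    (h22 : N22At (rateCarriersOfRecord₁₃CoPH 𝔯 F θ hP g₀ os k).u3) (hC₉ : 0 ≤ ℓ.C₉) (hω0 : 0 ≤ ℓ.ω) (hω1 : ℓ.ω < 1) (hγ : 0 < θ.γ)
    {γ' : ℝ} (hγ' : γ' ≤ θ.γ) :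
    ∃ E₀ : ℝ, 0 ≤ E₀ ∧ DecayBound (rateCarriersOfRecord₁₃CoPH 𝔯 F θ hP g₀ os k).u3.EA (Window γ') E₀ (rateCarriersOfRecord₁₃CoPH 𝔯 F θ hP g₀ os k).u3.κ := by
  rw [u3_rateCarriersOfRecord₁₃CoPH_of_pin 𝔯 θ hP g₀ os ℓ hpin k] at h22 ⊢
  exact decayBound_atPin_of_windowed_all_of_n22At _ ℓ k hL hW h22 hC₉ hω0 hω1 hγ hγ'

end Pinned

end Summit.QuantumFields.YangMills.BalabanUVNodes.N19TubeDecayDirectionPairs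

end
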